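import Literature.MathematicalPhysics.QuantumFieldTheory.Balaban1983to89.Node00.TorusCoverLevels
import Literature.MathematicalPhysics.QuantumFieldTheory.Balaban1983to89.Node00.CarriersB8Cube

/-!
# NODE 00 — THE TORUS→`ℤᵈ` TWIN, FILE 39: the TORUS DOMAIN FAMILY OF A `CubeB8` DATUM — [6] (1.131)'s cube tower `{□_j}` of the `ℤᵈ` member pushed
# through the level covers `π_j` is a nested family `B6SectADomainsV1.Domains P` of the record's torus; its `Λ_j` lie UNDER print's `Λ′_j`
# (`c.lamS`), its fine regions are the cover images of the `□_j`; hence the (153) test-function rows for it with NO displayed identification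

Cell `pub-ymgap`, seat `pub-ymgap-dag-n07-e` generation 18 (R141 (C) s3 lineage «torus-vs-box twin», DAG node N07 = [15]; INTENT-39, bus 2026-08-28).
NEW leaf; CONSUMED BY NAME, nothing modified: module 38 `Node00.TorusCoverLevels` (`coverAt`, `blockOf_coverAt`, `iterBlockOf_cover`, `coverAt_eq_coverAt_iff`,
`coverAt_add_period`, `coverAt_valLift`, `rows153_h0_of_inGauge`, `rows153_hQ_of_inGauge`), n05-a's (1.131) tower `B8Eq131Cubes.(cube, sqLo, sqHi, inLo, inHi,
mem_cube_iff, cube_anti, cube_succ_subset)`, `B8Eq131CubesAdmissible.(smul_mem_cube_iff, smul_mem_cube_succ_iff, cubeFam_false_zero)`, n05-c's restriction sets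
`B8CubeMemberZd.(cubeLam, cubeLamS, cubeLamS_top, mem_cubeLam_zero_iff)`, node00-def-cube's datum `Node00.CubeB8` (`c.sq`, `c.lamS`), `B8Ineq132.Under`,
`B7Prop1Local.InBox`, p21's `B6SectADomainsV1.Domains` and the cell's `QuantumLattice.(blockMap, blockSites, mem_blockSites_iff)`.
[15] = [Balaban1985Variational]; [6] = [Balaban1985RegularSpaces]; [B6] = [Balaban1984PropagatorsII]; [I] = [Balaban1987RG1].

WHY.  The per-cube heart of [15] Sect. F ((152)–(164)) uses ONE cube tower `{□_j}` ((144) ∕ [6] (1.131)) on TWO carriers: the gauge `u`, the potential `A` with (152)–(153)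
come from [6] Prop. 6 ∕ Thm 2 at N05's `ℤᵈ` member, whose theorems speak of the tower `c.sq j = cubeFam …` and the restriction sets `c.lamS j` of a `CubeB8` datum `c`
(`Node00.GaugedBoundB8`, `IsLandau138 … (c.sq 0) c.lamS …`); the operators `H`, `G̃`, the constraint space `N(Q′)` and k0-s1's rows (`body_of_adm22_T4`) live on a torus
family `D : B6SectADomainsV1.Domains (F.P K)`.  For the (153) test form ([B6] (2.12)) the torus family's `N(Q′)` must be the one whose `Λ_j` lie under the datum's `Λ′_j`
(module 38's rows display exactly «`y ∈ Λs j → D.LamSite j (π_j y)`»).  THIS FILE builds that family FROM THE DATUM — `cubeDomains P a M ρ k` with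
`Ω_j^{(j)} := π_j '' [sqLo j, sqHi j]` (§2; nestedness = `blockOf_coverAt` + [6] «□_{j+1} ⊂ □_j») — and proves the identification outright (§3: `c.lamS j ∋ y ⇒ Λ_j ∋ π_j y`,
non-wrapping of `□₀` under `π` being the only hypothesis, the same `Set.InjOn (cover P) (c.sq 0)` as n07-w3's `injOn_cover_sq_zero`), together with «the fine region
`Ω_j` of the family is the cover image of `□_j`» (§3 `inOm_cubeDomains_cover_iff`) and the window clause «the `L^j`-blocks of `Λ′_j` lie in `□_j ⊆ □₀`» (§3).  §4: the rows
(h0)∕(hQ) of `Node00.sum_laplace_mul_diverg(_re)_eq_zero_of_isLandau138_cover` for EVERY `μ ∈ N(Q′)` of `cubeDomains`, keyed on the datum's own letters `c.sq 0`, `c.lamS`.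
The route UnitScaleTilt's centred tower `FlatCubeSequenceAligned.cubeSeqM x₀ …` is a DIFFERENT inhabitant of (144) (sup-balls, radii `radM`); its `Λ_j` are not the datum's
`Λ′_j`, so the rows cannot be discharged for it by inclusion — the S6 head keys the torus side on `cubeDomains` of the very datum the gauge theorems use (k0-s1-w3's
`body_of_adm22_T4` takes every `Adm22` family; `Adm22 (cubeDomains …)` is the sequel's item).

WHAT IS PROVED (kernel; every `Params`; `k ≤ m + K`; lattice geometry only — NO estimate of Bałaban).
§1 `labelBox` ∕ `mem_labelBox`; `under_iff_blockMap_eq` (n05-a's `Under L n s Z` ↔ `blockMap (L^n) Z = s`); `smul_mem_cube_succ_of_blockMap` (`blockMap L y ∈ □_{j+1}^{(j+1)} ⇒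
   L^j•y ∈ □_{j+1}`); `mem_cube_of_blockMap_inBox` ∕ `blockMap_inBox_of_mem_cube`; ★ `eq_of_coverAt_eq_of_injOn` (NON-WRAPPING TRANSFER: two level-`n` labels with the same
   cover, one under a fine point of the window `W`, the other with its whole fine block in `W`, `π` injective on `W` ⇒ equal); private arithmetic `blockMap_pow_succ_smul`,
   `under_succ_smul`, `sitesPerDir_zero_eq_pow_mul`.
§2 `cubeOm`, ★ `exists_inner_label_of_blockOf_mem_cubeOm` (a `j`-block inside `Ω_{j+1}` has a label in `□_{j+1}^{(j)}`), `inBox_sq_of_inBox_inner`,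
   `cubeDomains P a M ρ k hk : Domains P` (+ `cubeDomains_k`, `cubeDomains_Om_zero`, `cubeDomains_Om_pos`, `cubeDomains_Om_of_lt`, `mem_cubeDomains_Om_iff`,
   `coverAt_mem_cubeDomains_Om`).
§3 ★★ `not_deep_cubeDomains_of_mem_cubeLam` ∕ ★★ `lamSite_cubeDomains_of_mem_cubeLam` (`1 ≤ j ≤ k`), ★★ `lamSite_zero_cubeDomains` (`x ∈ □₀ ∖ □₁`),
   ★ `inOm_cubeDomains_cover_iff` (`x ∈ □₀`: `InOm j (π x) ↔ x ∈ □_j`), `blockSites_subset_cube_of_inBox`, `blockSites_subset_cube_zero_of_mem_cubeLamS`,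
   `cubeLamS_subset_lamShadow` (`1 ≤ j`).
§4 ★★★ `rows153_h0_cubeDomains` ∕ `rows153_hQ_cubeDomains` (raw letters) and ★★★ `rows153_h0_of_cubeB8` ∕ `rows153_hQ_of_cubeB8` (a `CubeB8 P.d P.L K Ω′` datum `c`,
   `X := c.sq 0`, `Λs := c.lamS`, `m := c.k`): n07-w3's rows for every `μ` with `(cubeDomains P c.a c.M c.ρ c.k hk).InGauge μ`, hypothesis `Set.InjOn (cover P) (c.sq 0)` only.
HONEST FRAMING: one definition of record (`cubeDomains`, with its level function `cubeOm`; + the plumbing `labelBox`) and lattice-geometric bookkeeping — nothing of [15]∕[6]∕[B6] analysis asserted; `Adm22` of the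
family NOT proved here; N07 ∕ N05 ∕ K0⁷ NOT discharged; stub 1 NOT closed; counts unmoved (5∕27); one finite T⁴ programme at fixed ε — NOT continuum ∕ ℝ⁴ ∕ OS ∕ mass gap ∕ Clay.
No `sorry`, no `instance`, no `notation`.
-/

noncomputable section

namespace Literature.MathematicalPhysics.QuantumFieldTheory.Balaban1983to89.Node00

open B15Eq112TorusCover (cover cover_apply)
open B14DomainGeom (Pt)
open B5Eq118OneStroke (iterBlockOf iterBlockOf_zero iterBlockOf_succ)
open B7Prop1Local (InBox)
open B8Ineq132 (Under)
open B8Eq131Cubes (cube sqLo sqHi inLo inHi mem_cube_iff cube_anti cube_succ_subset)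
open B8Eq131CubesAdmissible (smul_mem_cube_iff smul_mem_cube_succ_iff cubeFam_false_zero)
open B8CubeMemberZd (cubeLam cubeLamS cubeLamS_top mem_cubeLam_zero_iff inBox_sq_of_mem_cubeLamS)
open Literature.MathematicalPhysics.QuantumLattice (blockMap blockSites mem_blockSites_iff)

variable {P : Params}

/-! ## §1  Label boxes, blocks, and the non-wrapping transfer -/

section Plumbing

/-- The finite box of integer labels `[lo, hi] ⊂ ℤᵈ` (plumbing for the `Finset`-valued `Ω_j^{(j)}` of `Domains`). [folklore] -/
def labelBox (lo hi : Pt P.d) : Finset (Pt P.d) := Fintype.piFinset fun i => Finset.Icc (lo i) (hi i)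

/-- Membership in the label box is n05-a's `InBox`. [cite: Balaban1985RegularSpaces, (1.131) p.99 (bookkeeping)] -/
@[simp] theorem mem_labelBox {lo hi z : Pt P.d} : z ∈ labelBox lo hi ↔ InBox lo hi z := by
  simp [labelBox, InBox, Fintype.mem_piFinset, Finset.mem_Icc]

/-- n05-a's «`Z` lies in the `L^n`-block of `s`» IS «the `L^n`-block label of `Z` is `s`». [cite: Balaban1985RegularSpaces, (1.4) p.77 («Ω_j = Bʲ(Ω_j^{(j)})»)] -/
theorem under_iff_blockMap_eq (n : ℕ) (s Z : Pt P.d) : Under P.L n s Z ↔ blockMap (P.L ^ n) Z = s := by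
  have hN : (0 : ℤ) < (P.L : ℤ) ^ n := pow_pos (by exact_mod_cast P.L_pos) n
  constructor
  · intro h
    funext i
    obtain ⟨h1, h2⟩ := h i
    simp only [blockMap]
    push_cast
    rw [Int.ediv_eq_iff_of_pos hN]
    constructor <;> linarith
  · intro h i
    have hi := congrFun h i
    simp only [blockMap] at hi
    push_cast at hi
    rw [Int.ediv_eq_iff_of_pos hN] at hi
    constructor <;> linarith

/-- `⌊(L^j·y)∕L^{j+1}⌋ = ⌊y∕L⌋` coordinatewise. [folklore] -/
private theorem blockMap_pow_succ_smul (j : ℕ) (y : Pt P.d) : blockMap (P.L ^ (j + 1)) (((P.L : ℤ) ^ j) • y) = blockMap P.L y := by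
  funext i
  simp only [blockMap, Pi.smul_apply, smul_eq_mul]
  push_cast
  rw [pow_succ, Int.mul_ediv_mul_of_pos _ _ (pow_pos (by exact_mod_cast P.L_pos) j)]

/-- The fine point `L^j•y` lies in the `L^{j+1}`-block of `⌊y∕L⌋`. [folklore] -/
private theorem under_succ_smul (j : ℕ) (y : Pt P.d) : Under P.L (j + 1) (blockMap P.L y) (((P.L : ℤ) ^ j) • y) :=
  (under_iff_blockMap_eq _ _ _).2 (blockMap_pow_succ_smul j y)

/-- **If the `L`-block label of the level-`j` label `y` lies in `□_{j+1}^{(j+1)}`, the fine point `L^j•y` lies in `□_{j+1}`** («□_{j+1} = B^{j+1}(□_{j+1}^{(j+1)})»).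
[cite: Balaban1985RegularSpaces, (1.4) p.77, p.98 («for every j the cube □_j is a sum of the big blocks»)] -/
theorem smul_mem_cube_succ_of_blockMap {a : Pt P.d} {M ρ k j : ℕ} {y : Pt P.d}
    (h : InBox (sqLo P.L a ρ k (j + 1)) (sqHi P.L a M ρ k (j + 1)) (blockMap P.L y)) :
    ((P.L : ℤ) ^ j) • y ∈ cube P.L a M ρ k (j + 1) :=
  (mem_cube_iff P.L_pos).2 ⟨_, h, under_succ_smul j y⟩

/-- A fine point whose `L^n`-block label lies in `□_n^{(n)}` lies in `□_n`. [cite: Balaban1985RegularSpaces, (1.4) p.77, p.98] -/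
theorem mem_cube_of_blockMap_inBox {a : Pt P.d} {M ρ k n : ℕ} {Z : Pt P.d}
    (h : InBox (sqLo P.L a ρ k n) (sqHi P.L a M ρ k n) (blockMap (P.L ^ n) Z)) : Z ∈ cube P.L a M ρ k n :=
  (mem_cube_iff P.L_pos).2 ⟨_, h, (under_iff_blockMap_eq _ _ _).2 rfl⟩

/-- Conversely a point of `□_n` has its `L^n`-block label in `□_n^{(n)}`. [cite: Balaban1985RegularSpaces, (1.4) p.77, p.98] -/
theorem blockMap_inBox_of_mem_cube {a : Pt P.d} {M ρ k n : ℕ} {Z : Pt P.d} (h : Z ∈ cube P.L a M ρ k n) :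
    InBox (sqLo P.L a ρ k n) (sqHi P.L a M ρ k n) (blockMap (P.L ^ n) Z) := by
  obtain ⟨z, hz, hU⟩ := (mem_cube_iff P.L_pos).1 h
  rwa [← (under_iff_blockMap_eq _ _ _).1 hU] at hz

/-- The fine period is `L^n` times the level-`n` period (`n ≤ m + K`). [cite: Balaban1987RG1, (0.1) p.251] -/
private theorem sitesPerDir_zero_eq_pow_mul {n : ℕ} (hn : n ≤ P.m + P.K) : P.sitesPerDir 0 = P.L ^ n * P.sitesPerDir n := by
  simp only [Params.sitesPerDir, Nat.sub_zero]
  rw [mul_left_comm, ← pow_add, Nat.add_sub_cancel' hn]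

/-- ★ **THE NON-WRAPPING TRANSFER.**  Let `t, s ∈ ℤᵈ` be level-`n` labels with the same level-`n` cover, `π_n t = π_n s` (`n ≤ m + K`).  If some fine point `X` of the window
`W` lies in the `L^n`-block of `t`, the whole `L^n`-block of `s` lies in `W`, and `π` is injective on `W`, then `t = s`: the deck translate of `X` landing in the block of `s` is
a second point of `W` with the same cover. [cite: Balaban1987RG1, (0.1) p.251] -/
theorem eq_of_coverAt_eq_of_injOn {n : ℕ} (hn : n ≤ P.m + P.K) {W : Set (Pt P.d)} (hinj : Set.InjOn (cover P) W) {t s X : Pt P.d}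
    (hts : coverAt P n t = coverAt P n s) (hXt : blockMap (P.L ^ n) X = t) (hXW : X ∈ W) (hsW : ∀ Z, blockMap (P.L ^ n) Z = s → Z ∈ W) : t = s := by
  have hdvd := (coverAt_eq_coverAt_iff n t s).1 hts
  choose v hv using hdvd
  set X' : Pt P.d := X + fun μ => ((P.sitesPerDir 0 : ℕ) : ℤ) * v μ with hX'
  have hcov : cover P X' = cover P X := by
    rw [hX', ← coverAt_zero]; exact coverAt_add_period 0 X v
  have hblk : blockMap (P.L ^ n) X' = s := by
    funext μ
    have hXμ := congrFun hXt μ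
    simp only [blockMap] at hXμ ⊢
    rw [hX', Pi.add_apply, sitesPerDir_zero_eq_pow_mul hn]
    push_cast at hXμ ⊢
    rw [show X μ + (P.L : ℤ) ^ n * (P.sitesPerDir n : ℤ) * v μ = X μ + (P.L : ℤ) ^ n * ((P.sitesPerDir n : ℤ) * v μ) by ring,
      Int.add_mul_ediv_left _ _ (pow_ne_zero _ (by exact_mod_cast P.L_pos.ne')), hXμ]
    linarith [hv μ]
  have hX'W : X' ∈ W := hsW X' hblk
  have heq : X' = X := hinj hX'W hXW hcov
  funext μ
  have h0 : ((P.sitesPerDir 0 : ℕ) : ℤ) * v μ = 0 := by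
    have := congrFun heq μ
    simp only [hX', Pi.add_apply] at this
    linarith
  have hper : ((P.sitesPerDir 0 : ℕ) : ℤ) ≠ 0 := by exact_mod_cast P.sitesPerDir_ne_zero 0
  have hv0 : v μ = 0 := (mul_eq_zero.1 h0).resolve_left hper
  have := hv μ
  rw [hv0, mul_zero] at this
  linarith

end Plumbing

/-! ## §2  The torus domain family of a cube tower -/

section Family

variable (P) in
/-- The level sets of the torus family of the (1.131) tower (see `cubeDomains`): `T` at level `0`, `π_j '' [sqLo j, sqHi j]` for `1 ≤ j ≤ k`, `∅` above `k`.
[cite: Balaban1985RegularSpaces, (1.131) p.99; Balaban1984PropagatorsII, (2.1) p.224] -/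
def cubeOm (a : Pt P.d) (M ρ k : ℕ) (j : ℕ) : Finset (Site P j) :=
  if j = 0 then Finset.univ else if j ≤ k then (labelBox (sqLo P.L a ρ k j) (sqHi P.L a M ρ k j)).image (coverAt P j) else ∅

/-- ★ **A `j`-BLOCK INSIDE `Ω_{j+1}` HAS A LABEL IN `□_{j+1}^{(j)}`** (`1 ≤ j < k ≤ m + K`): if `blockOf y ∈ π_{j+1} '' □_{j+1}^{(j+1)}` then `y = π_j s` for some
`s ∈ [inLo j, inHi j] = □_{j+1}^{(j)}` — lift `y` to labels and move by a deck translation of `T^{(j)}` into the `L`-block over the witness. [cite: Balaban1985RegularSpaces, (1.131) p.99 («Λ′_j = □_j^{(j)} ∖ □_{j+1}^{(j)}»); Balaban1987RG1, (0.1) p.251] -/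
theorem exists_inner_label_of_blockOf_mem_cubeOm {a : Pt P.d} {M ρ k : ℕ} (hk : k ≤ P.m + P.K) {j : ℕ} (hj : 1 ≤ j) (hjk : j < k) {y : Site P j}
    (hy : blockOf y ∈ cubeOm P a M ρ k (j + 1)) : ∃ s, InBox (inLo P.L a ρ k j) (inHi P.L a M ρ k j) s ∧ coverAt P j s = y := by
  have hy' : blockOf y ∈ (labelBox (sqLo P.L a ρ k (j + 1)) (sqHi P.L a M ρ k (j + 1))).image (coverAt P (j + 1)) := by
    have h1 : j + 1 ≠ 0 := by omega
    have h2 : j + 1 ≤ k := by omega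
    simpa [cubeOm, h1, h2] using hy
  obtain ⟨s, hs, hse⟩ := Finset.mem_image.1 hy'
  rw [mem_labelBox] at hs
  set yl : Pt P.d := fun μ => ((y μ).val : ℤ) with hyl
  have hyc : coverAt P j yl = y := coverAt_valLift j y
  have hb : blockOf y = coverAt P (j + 1) (blockMap P.L yl) := by rw [← hyc, blockOf_coverAt (by omega)]
  have hdvd := (coverAt_eq_coverAt_iff (j + 1) (blockMap P.L yl) s).1 (hb.symm.trans hse.symm)
  choose v hv using hdvd
  set y' : Pt P.d := yl + fun μ => ((P.sitesPerDir j : ℕ) : ℤ) * v μ with hy'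
  have hyc' : coverAt P j y' = y := by rw [hy', coverAt_add_period, hyc]
  have hblk : blockMap P.L y' = s := by
    funext μ
    simp only [blockMap, hy', Pi.add_apply, P.sitesPerDir_eq_mul_succ (show j + 1 ≤ P.m + P.K by omega)]
    push_cast
    rw [show yl μ + (P.sitesPerDir (j + 1) : ℤ) * (P.L : ℤ) * v μ = yl μ + (P.L : ℤ) * ((P.sitesPerDir (j + 1) : ℤ) * v μ) by ring,
      Int.add_mul_ediv_left _ _ (by exact_mod_cast P.L_pos.ne')]
    have := hv μ
    simp only [blockMap] at this
    linarith
  exact ⟨y', (smul_mem_cube_succ_iff P.L_pos a M ρ hjk y').1 (smul_mem_cube_succ_of_blockMap (hblk ▸ hs)), hyc'⟩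

/-- `□_{j+1}^{(j)} ⊆ □_j^{(j)}` in labels (`j < k`). [cite: Balaban1985RegularSpaces, p.98 («□_j ⊃ □_{j+1}»)] -/
theorem inBox_sq_of_inBox_inner {a : Pt P.d} {M ρ k j : ℕ} (hjk : j < k) {s : Pt P.d} (hs : InBox (inLo P.L a ρ k j) (inHi P.L a M ρ k j) s) :
    InBox (sqLo P.L a ρ k j) (sqHi P.L a M ρ k j) s :=
  (smul_mem_cube_iff P.L_pos a M ρ k j s).1 (cube_succ_subset hjk ((smul_mem_cube_succ_iff P.L_pos a M ρ hjk s).2 hs))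

variable (P) in
/-- **THE TORUS DOMAIN FAMILY OF THE (1.131) CUBE TOWER** with corner `a`, side `M`, collar `ρ`, depth `k` (the parameters of a `CubeB8` datum): `Ω₀^{(0)} = T`,
`Ω_j^{(j)} := π_j '' □_j^{(j)} = π_j '' [sqLo j, sqHi j]` for `1 ≤ j ≤ k`, `∅` above `k` — a nested family in the sense of [B6] (2.1) (`B6SectADomainsV1.Domains`); nestedness
from [6] «□_j ⊃ □_{j+1}» read through `blockOf_coverAt`. [cite: Balaban1985RegularSpaces, (1.131) p.99; Balaban1985Variational, (144) p.300; Balaban1984PropagatorsII, (2.1) p.224] -/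
def cubeDomains (a : Pt P.d) (M ρ k : ℕ) (hk : k ≤ P.m + P.K) : B6SectADomainsV1.Domains P where
  k := k
  hk := hk
  Om := cubeOm P a M ρ k
  Om_zero := by simp [cubeOm]
  Om_eq_empty j hj := by
    have h0 : j ≠ 0 := by omega
    simp [cubeOm, h0, not_le.mpr hj]
  nested j y hy := by
    by_cases hj0 : j = 0
    · subst hj0; simp [cubeOm]
    by_cases hjk : j + 1 ≤ k
    · obtain ⟨s, hs, hse⟩ := exists_inner_label_of_blockOf_mem_cubeOm hk (by omega) (by omega) hy
      have hjle : j ≤ k := by omega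
      simp only [cubeOm, hj0, hjle, if_false, if_true]
      exact Finset.mem_image.2 ⟨s, mem_labelBox.2 (inBox_sq_of_inBox_inner (by omega) hs), hse⟩
    · exfalso
      simp [cubeOm, hjk] at hy

variable {a : Pt P.d} {M ρ k : ℕ} {hk : k ≤ P.m + P.K}

/-- top level. [cite: Balaban1985RegularSpaces, (1.131) p.99] -/
@[simp] theorem cubeDomains_k : (cubeDomains P a M ρ k hk).k = k := rfl

/-- `Ω₀^{(0)} = T`. [cite: Balaban1984PropagatorsII, (2.1) p.224] -/
theorem cubeDomains_Om_zero : (cubeDomains P a M ρ k hk).Om 0 = Finset.univ := rfl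

/-- the positive levels are the covered label boxes `π_j '' □_j^{(j)}`. [cite: Balaban1985RegularSpaces, (1.131) p.99] -/
theorem cubeDomains_Om_pos {j : ℕ} (hj : 1 ≤ j) (hjk : j ≤ k) :
    (cubeDomains P a M ρ k hk).Om j = (labelBox (sqLo P.L a ρ k j) (sqHi P.L a M ρ k j)).image (coverAt P j) := by
  have h0 : j ≠ 0 := by omega
  simp [cubeDomains, cubeOm, h0, hjk]

/-- no levels above `k`. [cite: Balaban1984PropagatorsII, (2.1) p.224] -/
theorem cubeDomains_Om_of_lt {j : ℕ} (hj : k < j) : (cubeDomains P a M ρ k hk).Om j = ∅ :=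
  (cubeDomains P a M ρ k hk).Om_eq_empty hj

/-- membership at a positive level. [cite: Balaban1985RegularSpaces, (1.131) p.99] -/
theorem mem_cubeDomains_Om_iff {j : ℕ} (hj : 1 ≤ j) (hjk : j ≤ k) (y : Site P j) :
    y ∈ (cubeDomains P a M ρ k hk).Om j ↔ ∃ s, InBox (sqLo P.L a ρ k j) (sqHi P.L a M ρ k j) s ∧ coverAt P j s = y := by
  rw [cubeDomains_Om_pos hj hjk, Finset.mem_image]
  simp

/-- a label of `□_j^{(j)}` covers a site of `Ω_j^{(j)}`. [cite: Balaban1985RegularSpaces, (1.131) p.99] -/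
theorem coverAt_mem_cubeDomains_Om {j : ℕ} (hj : 1 ≤ j) (hjk : j ≤ k) {y : Pt P.d} (hy : InBox (sqLo P.L a ρ k j) (sqHi P.L a M ρ k j) y) :
    coverAt P j y ∈ (cubeDomains P a M ρ k hk).Om j :=
  (mem_cubeDomains_Om_iff hj hjk _).2 ⟨y, hy, rfl⟩

end Family

/-! ## §3  The identification: print's `Λ′_j` lie over the family's `Λ_j`; the fine regions are the cover images of the `□_j` -/

section Identification

variable {a : Pt P.d} {M ρ k : ℕ} {hk : k ≤ P.m + P.K}

/-- ★★ **A LABEL OF `Λ′_j` IS NOT DEEP** (`1 ≤ j ≤ k`; `π` injective on `□₀`): for `y ∈ Λ′_j = □_j^{(j)} ∖ □_{j+1}^{(j)}` the `(j+1)`-block of `π_j y` is not in `Ω_{j+1}^{(j+1)}`.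
[cite: Balaban1985RegularSpaces, (1.131) p.99; Balaban1984PropagatorsII, (2.3) p.224] -/
theorem not_deep_cubeDomains_of_mem_cubeLam (hinj : Set.InjOn (cover P) (cube P.L a M ρ k 0)) {j : ℕ} (hjk : j ≤ k) {y : Pt P.d}
    (hy : y ∈ cubeLam P.L a M ρ k j) : ¬ (cubeDomains P a M ρ k hk).Deep j (coverAt P j y) := by
  intro hdeep
  unfold B6SectADomainsV1.Domains.Deep at hdeep
  rcases Nat.lt_or_ge j k with hjlt | hjge
  · rw [blockOf_coverAt (by omega : j + 1 ≤ P.m + P.K), mem_cubeDomains_Om_iff (by omega) (by omega)] at hdeep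
    obtain ⟨s, hs, hse⟩ := hdeep
    -- non-wrapping transfer at level `j+1`: `blockMap L y = s`
    have hyb : InBox (sqLo P.L a ρ k j) (sqHi P.L a M ρ k j) y := hy.1
    have hX : ((P.L : ℤ) ^ j) • y ∈ cube P.L a M ρ k 0 := cube_anti (Nat.zero_le j) hjk ((smul_mem_cube_iff P.L_pos a M ρ k j y).2 hyb)
    have heq : blockMap P.L y = s :=
      eq_of_coverAt_eq_of_injOn (by omega) hinj hse.symm (blockMap_pow_succ_smul j y) hX
        (fun Z hZ => cube_anti (Nat.zero_le _) (by omega) (mem_cube_of_blockMap_inBox (n := j + 1) (hZ ▸ hs)))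
    have hin : ((P.L : ℤ) ^ j) • y ∈ cube P.L a M ρ k (j + 1) := smul_mem_cube_succ_of_blockMap (heq ▸ hs)
    exact hy.2 hjlt ((smul_mem_cube_succ_iff P.L_pos a M ρ hjlt y).1 hin)
  · have hjk' : j = k := le_antisymm hjk hjge
    subst hjk'
    rw [cubeDomains_Om_of_lt (Nat.lt_succ_self _)] at hdeep
    exact absurd hdeep (Finset.notMem_empty _)

/-- ★★ **PRINT'S `Λ′_j` LIES OVER THE FAMILY'S `Λ_j`** (`1 ≤ j ≤ k`; `π` injective on `□₀`): `y ∈ Λ′_j ⇒ π_j y ∈ Λ_j`.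
[cite: Balaban1985RegularSpaces, (1.131) p.99; Balaban1984PropagatorsII, (2.3) p.224] -/
theorem lamSite_cubeDomains_of_mem_cubeLam (hinj : Set.InjOn (cover P) (cube P.L a M ρ k 0)) {j : ℕ} (hj : 1 ≤ j) (hjk : j ≤ k) {y : Pt P.d}
    (hy : y ∈ cubeLam P.L a M ρ k j) : (cubeDomains P a M ρ k hk).LamSite j (coverAt P j y) :=
  ⟨coverAt_mem_cubeDomains_Om hj hjk hy.1, not_deep_cubeDomains_of_mem_cubeLam hinj hjk hy⟩

/-- ★★ **LEVEL `0`: a fine point of `□₀ ∖ □₁` covers a site of `Λ₀ = Ω₁ᶜ`** (`1 ≤ k`; `π` injective on `□₀`). [cite: Balaban1985RegularSpaces, (1.131) p.99; Balaban1984PropagatorsII, (2.3) p.224] -/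
theorem lamSite_zero_cubeDomains (hinj : Set.InjOn (cover P) (cube P.L a M ρ k 0)) (hk1 : 1 ≤ k) {x : Pt P.d}
    (hx0 : x ∈ cube P.L a M ρ k 0) (hx1 : x ∉ cube P.L a M ρ k 1) : (cubeDomains P a M ρ k hk).LamSite 0 (cover P x) := by
  rw [B6SectADomainsV1.Domains.lamSite_zero_iff]
  intro hdeep
  unfold B6SectADomainsV1.Domains.Deep at hdeep
  rw [← coverAt_zero, blockOf_coverAt (by omega : 0 + 1 ≤ P.m + P.K), mem_cubeDomains_Om_iff le_rfl hk1] at hdeep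
  obtain ⟨s, hs, hse⟩ := hdeep
  have heq : blockMap P.L x = s :=
    eq_of_coverAt_eq_of_injOn (n := 0 + 1) (by omega) hinj hse.symm (by rw [zero_add, pow_one]) hx0
      (fun Z hZ => cube_anti (Nat.zero_le _) hk1 (mem_cube_of_blockMap_inBox (n := 0 + 1) (hZ ▸ hs)))
  have : ((P.L : ℤ) ^ 0) • x ∈ cube P.L a M ρ k (0 + 1) := smul_mem_cube_succ_of_blockMap (heq ▸ hs)
  rw [pow_zero, one_smul] at this
  exact hx1 this

/-- ★ **THE FINE REGIONS OF THE FAMILY ARE THE COVER IMAGES OF THE CUBES**: for `x ∈ □₀` and `1 ≤ j ≤ k`, `π x ∈ Ω_j` (`InOm j`) iff `x ∈ □_j` (`π` injective on `□₀`).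
[cite: Balaban1985RegularSpaces, (1.131) p.99; Balaban1984PropagatorsII, (2.2) p.224] -/
theorem inOm_cubeDomains_cover_iff (hinj : Set.InjOn (cover P) (cube P.L a M ρ k 0)) {j : ℕ} (hj : 1 ≤ j) (hjk : j ≤ k) {x : Pt P.d}
    (hx0 : x ∈ cube P.L a M ρ k 0) : (cubeDomains P a M ρ k hk).InOm j (cover P x) ↔ x ∈ cube P.L a M ρ k j := by
  unfold B6SectADomainsV1.Domains.InOm
  rw [iterBlockOf_cover (hjk.trans hk), mem_cubeDomains_Om_iff hj hjk]
  constructor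
  · rintro ⟨s, hs, hse⟩
    have heq : blockMap (P.L ^ j) x = s :=
      eq_of_coverAt_eq_of_injOn (hjk.trans hk) hinj hse.symm rfl hx0
        (fun Z hZ => cube_anti (Nat.zero_le _) hjk (mem_cube_of_blockMap_inBox (hZ ▸ hs)))
    exact mem_cube_of_blockMap_inBox (heq ▸ hs)
  · intro hx
    exact ⟨_, blockMap_inBox_of_mem_cube hx, rfl⟩

/-- The `L^j`-block of a label of `□_j^{(j)}` lies in `□_j`. [cite: Balaban1985RegularSpaces, p.98 («□_j is a sum of the big blocks of the lattice T_{L^{−j}}»)] -/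
theorem blockSites_subset_cube_of_inBox {j : ℕ} {y : Pt P.d} (hy : InBox (sqLo P.L a ρ k j) (sqHi P.L a M ρ k j) y) :
    (↑(blockSites (P.L ^ j) y) : Set (Pt P.d)) ⊆ cube P.L a M ρ k j := by
  haveI : NeZero (P.L ^ j) := ⟨(pow_pos P.L_pos j).ne'⟩
  intro x hx
  rw [Finset.mem_coe, mem_blockSites_iff] at hx
  exact mem_cube_of_blockMap_inBox (hx ▸ hy)

/-- The `L^j`-block of a restriction label `y ∈ c.lamS j` (`j ≤ k`) lies in the window `□₀`. [cite: Balaban1985RegularSpaces, (1.131) p.99, p.98] -/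
theorem blockSites_subset_cube_zero_of_mem_cubeLamS {j : ℕ} (hjk : j ≤ k) {y : Pt P.d} (hy : y ∈ cubeLamS P.L a M ρ k k j) :
    (↑(blockSites (P.L ^ j) y) : Set (Pt P.d)) ⊆ cube P.L a M ρ k 0 :=
  (blockSites_subset_cube_of_inBox (inBox_sq_of_mem_cubeLamS hy)).trans (cube_anti (Nat.zero_le _) hjk)

/-- The restriction sets of positive level lie in module 38's shadow of the family's `Λ_j`. [cite: Balaban1985RegularSpaces, (1.131) p.99; Balaban1984PropagatorsII, (2.3) p.224] -/
theorem cubeLamS_subset_lamShadow (hinj : Set.InjOn (cover P) (cube P.L a M ρ k 0)) {j : ℕ} (hj : 1 ≤ j) (hjk : j ≤ k) :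
    cubeLamS P.L a M ρ k k j ⊆ lamShadow (cubeDomains P a M ρ k hk) j := by
  intro y hy
  rw [cubeLamS_top P.L a M ρ hjk] at hy
  exact lamSite_cubeDomains_of_mem_cubeLam hinj hj hjk hy

end Identification

/-! ## §4  The (153) test-function rows for the family, keyed on the datum's own letters -/

section Rows

variable {a : Pt P.d} {M ρ k : ℕ} {hk : k ≤ P.m + P.K}

/-- ★★★ **ROW (h0) FOR THE CUBE FAMILY**: every `μ ∈ N(Q′)` of `cubeDomains` vanishes at the covers of the level-`0` restriction sites `ℭ_k ∩ T_η = □₀ ∖ □₁` inside the window `□₀`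
(`1 ≤ k`, `π` injective on `□₀`). [cite: Balaban1984PropagatorsII, (2.7) p.224, (2.12) p.225; Balaban1985Variational, (153) p.301; Balaban1985RegularSpaces, (1.131) p.99] -/
theorem rows153_h0_cubeDomains (hinj : Set.InjOn (cover P) (cube P.L a M ρ k 0)) (hk1 : 1 ≤ k) {μ : Site P 0 → ℝ}
    (hμ : (cubeDomains P a M ρ k hk).InGauge μ) :
    ∀ x ∈ cube P.L a M ρ k 0, x ∈ cubeLamS P.L a M ρ k k 0 → μ (cover P x) = 0 :=
  rows153_h0_of_inGauge _ hμ fun x hx hx0 => by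
    rw [cubeLamS_top P.L a M ρ (Nat.zero_le k), mem_cubeLam_zero_iff P.L_pos a M ρ hk1] at hx0
    exact lamSite_zero_cubeDomains hinj hk1 hx hx0.2

/-- ★★★ **ROW (hQ) FOR THE CUBE FAMILY**: every `μ ∈ N(Q′)` of `cubeDomains` has vanishing lifted `L^j`-block sums at the restriction labels `Λ′_j`, `1 ≤ j ≤ k`, with the
window `□₀` (`π` injective on `□₀`). [cite: Balaban1984PropagatorsII, (2.7) p.224, (2.12) p.225; Balaban1985Variational, (153) p.301; Balaban1985RegularSpaces, (1.131) p.99] -/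
theorem rows153_hQ_cubeDomains (hinj : Set.InjOn (cover P) (cube P.L a M ρ k 0)) {μ : Site P 0 → ℝ} (hμ : (cubeDomains P a M ρ k hk).InGauge μ) :
    ∀ j, 1 ≤ j → j ≤ k → ∀ y ∈ cubeLamS P.L a M ρ k k j,
      ∑ x ∈ blockSites (P.L ^ j) y, (cube P.L a M ρ k 0).indicator (fun z => μ (cover P z)) x = 0 :=
  rows153_hQ_of_inGauge _ hμ fun _ hj hjk _ hy =>
    ⟨cubeLamS_subset_lamShadow hinj hj hjk hy, blockSites_subset_cube_zero_of_mem_cubeLamS hjk hy⟩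

variable {K : ℕ} {Ω' : ℕ → Set (Pt P.d)}

/-- `c.sq 0 = □₀` for a `CubeB8` datum (n05-a's `cubeFam_false_zero`). [cite: Balaban1985RegularSpaces, (1.131) p.99] -/
theorem CubeB8.sq_zero_eq_cube (c : CubeB8 P.d P.L K Ω') : c.sq 0 = cube P.L c.a c.M c.ρ c.k 0 := cubeFam_false_zero _ _ _ _ _

/-- ★★★ **ROW (h0) AT A `CubeB8` DATUM**, in the letters `c.sq 0`, `c.lamS` of `Node00.GaugedBoundB8` ∕ `IsLandau138`: for the torus family of the datum and every `μ ∈ N(Q′)`,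
n07-w3's `h0` with `X := c.sq 0`, `Λs := c.lamS`. [cite: Balaban1984PropagatorsII, (2.7) p.224, (2.12) p.225; Balaban1985Variational, (153) p.301; Balaban1985RegularSpaces, (1.131) p.99] -/
theorem rows153_h0_of_cubeB8 (c : CubeB8 P.d P.L K Ω') (hck : c.k ≤ P.m + P.K) (hinj : Set.InjOn (cover P) (c.sq 0)) {μ : Site P 0 → ℝ}
    (hμ : (cubeDomains P c.a c.M c.ρ c.k hck).InGauge μ) :
    ∀ x ∈ c.sq 0, x ∈ c.lamS 0 → μ (cover P x) = 0 := by
  rw [CubeB8.sq_zero_eq_cube] at hinj ⊢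
  exact rows153_h0_cubeDomains hinj c.one_le_k hμ

/-- ★★★ **ROW (hQ) AT A `CubeB8` DATUM** (`m := c.k`), letters `c.sq 0`, `c.lamS`. [cite: Balaban1984PropagatorsII, (2.7) p.224, (2.12) p.225; Balaban1985Variational, (153) p.301; Balaban1985RegularSpaces, (1.131) p.99] -/
theorem rows153_hQ_of_cubeB8 (c : CubeB8 P.d P.L K Ω') (hck : c.k ≤ P.m + P.K) (hinj : Set.InjOn (cover P) (c.sq 0)) {μ : Site P 0 → ℝ}
    (hμ : (cubeDomains P c.a c.M c.ρ c.k hck).InGauge μ) :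
    ∀ j, 1 ≤ j → j ≤ c.k → ∀ y ∈ c.lamS j, ∑ x ∈ blockSites (P.L ^ j) y, (c.sq 0).indicator (fun z => μ (cover P z)) x = 0 := by
  rw [CubeB8.sq_zero_eq_cube] at hinj ⊢
  exact rows153_hQ_cubeDomains hinj hμ

/-- ★ **THE FINE REGIONS OF THE DATUM'S TORUS FAMILY ARE THE COVER IMAGES OF `c.sq j`** (`x ∈ c.sq 0`, `1 ≤ j ≤ c.k`).
[cite: Balaban1985RegularSpaces, (1.131) p.99; Balaban1984PropagatorsII, (2.2) p.224] -/
theorem inOm_cubeDomains_iff_mem_sq (c : CubeB8 P.d P.L K Ω') (hck : c.k ≤ P.m + P.K) (hinj : Set.InjOn (cover P) (c.sq 0)) {j : ℕ} (hj : 1 ≤ j)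
    (hjk : j ≤ c.k) {x : Pt P.d} (hx : x ∈ c.sq 0) : (cubeDomains P c.a c.M c.ρ c.k hck).InOm j (cover P x) ↔ x ∈ c.sq j := by
  rw [CubeB8.sq_zero_eq_cube] at hinj hx
  rw [show c.sq j = cube P.L c.a c.M c.ρ c.k j from B8Eq131CubesAdmissible.cubeFam_false_of_le _ _ _ _ hjk]
  exact inOm_cubeDomains_cover_iff hinj hj hjk hx

end Rows

end Literature.MathematicalPhysics.QuantumFieldTheory.Balaban1983to89.Node00

end
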